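import Mathlib
import Summits.NavierStokesRegularity.NavierStokesRegularity.Theorems.HeteroclinicTriggerChainTriggerChainFrontStepTruncWindows
import HarnessLib

/-!
# `HeteroclinicTriggerChain` — crux `TriggerChainFrontStep` (item stmt-NavierStokesRegularity-22785):
  the DELAY PHASE of the hop in the seeded two-shell truncation — core step of the bootstrap

The seeded two-shell truncation of the pinned table `α₀ + βσ` (carrier `x`, trigger `u`, receiver `y`, upper
trigger `v`; rates `e > 0`, `g ≥ 0` at the front shell, `e' ≥ 0` at the next shell, seed `β ≥ 0`):
`x′ = −eu² − βuv`, `u′ = exu − guy`, `y′ = gu² − e′v²`, `v′ = βxu + e′yv` (energy-conserving).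
`heteroclinicTriggerChain_trunc_delay_core` is the IMPROVEMENT STEP of the continuity argument for the delay
phase (the passage near the pure-mode saddle `(1,0,0,0)` while the trigger has not ignited, `u ≤ h`): on a
window `[0, t]` where the WEAK drift bounds `x ≥ 1 − 2δ₁`, `y ≤ 2δ₂` hold, the STRONG bounds
`1 − δ₁ ≤ x ≤ 1`, `y(0) ≤ y ≤ δ₂`, `0 ≤ v ≤ e^{2Λ}(v(0) + 2βu/e)` hold, together with the two-sided
exponential law `u(0)e^{e(1−ε)s} ≤ u(s) ≤ u(0)e^{es}` (`ε = δ₁ + gδ₂/e`) and the collected seed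
`v ≥ v(0) + β(1−δ₁)(u − u(0))/e`. It chains the window estimates of `…TruncWindows`: weak bounds ⇒ rate
`ex − gy ≥ e/2` ⇒ `u` non-decreasing, `v ≥ 0`, centre drift `v ≤ e^{2Λ}(v(0)+2βu/e) ≤ V` ⇒ the pump beats
the drain (`e′v² ≤ gu²` under `4e′e^{4Λ}v(0)² ≤ gu(0)²`, `16e′β²e^{4Λ} ≤ ge²`) ⇒ receiver and carrier
windows ⇒ strong bounds ⇒ strong rate bounds `e(1−ε) ≤ ex − gy ≤ e` ⇒ exponential law and seed. The
bootstrap itself and the ignition-time law are in `…TruncPassage`.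

HONEST FRAMING: elementary facts about a four-dimensional quadratic ODE (a MODEL truncation of Tao's lattice,
Tao 2016 §4); helper for the crux, no stub credit; nothing here is a statement about the Navier–Stokes
equations; no summit, rung or crux is proved. NS regularity is not proved by this line.
-/

noncomputable section

-- the sub-problem namespace `Summit.NavierStokesRegularity.NavierStokesRegularity` repeats the summit name by design (D-0017)
set_option linter.dupNamespace false

open Real Set

namespace Summit.NavierStokesRegularity.NavierStokesRegularity.Theorems

/-! ### The delay phase: core step (weak bounds improve to strong bounds) -/

set_option maxHeartbeats 400000 in
/-- **Delay phase, core step of the bootstrap.** In the seeded two-shell truncation with energy `≤ 1`,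
`u(0) > 0`, `y(0), v(0) ≥ 0`, on a window `[0, t]` where the trigger has not ignited (`u ≤ h`) and the
WEAK drift bounds `x ≥ 1 − 2δ₁`, `y ≤ 2δ₂` hold, the STRONG bounds hold:
`1 − δ₁ ≤ x ≤ 1`, `y(0) ≤ y ≤ δ₂`, `0 ≤ v ≤ e^{2Λ}(v(0) + 2βu/e)`, together with the two-sided
exponential law `u(0)e^{e(1−ε)s} ≤ u(s) ≤ u(0)e^{es}` (`ε = δ₁ + gδ₂/e`) and the collected seed
`v ≥ v(0) + β(1−δ₁)(u − u(0))/e`. Constants: `δ₂ ≥ y(0) + gh²/e`, `Λ ≥ e′δ₂t`,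
`V ≥ e^{2Λ}(v(0) + 2βh/e)`, `δ₁ ≥ 1 − x(0) + h² + 2βVh/e`, smallness `2δ₁ + 2gδ₂/e ≤ 1/2`,
`4e′e^{4Λ}v(0)² ≤ g u(0)²`, `16e′β²e^{4Λ} ≤ g e²`. [folklore] -/
theorem heteroclinicTriggerChain_trunc_delay_core (e g e' β : ℝ) (he : 0 < e) (hg : 0 ≤ g)
    (he' : 0 ≤ e') (hβ : 0 ≤ β) (x u y v : ℝ → ℝ)
    (hx : ∀ t, HasDerivAt x (-(e * u t ^ 2) - β * u t * v t) t)
    (hu : ∀ t, HasDerivAt u (e * x t * u t - g * u t * y t) t)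
    (hy : ∀ t, HasDerivAt y (g * u t ^ 2 - e' * v t ^ 2) t)
    (hv : ∀ t, HasDerivAt v (β * x t * u t + e' * y t * v t) t)
    (hE : x 0 ^ 2 + u 0 ^ 2 + y 0 ^ 2 + v 0 ^ 2 ≤ 1)
    (hu0 : 0 < u 0) (hy0 : 0 ≤ y 0) (hv0 : 0 ≤ v 0)
    {h Λ δ₁ δ₂ V t : ℝ}
    (hδ₂ : y 0 + g * h ^ 2 / e ≤ δ₂) (hΛt : e' * δ₂ * t ≤ Λ)
    (hV : Real.exp (2 * Λ) * (v 0 + 2 * β * h / e) ≤ V)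
    (hδ₁ : 1 - x 0 + h ^ 2 + 2 * β * V * h / e ≤ δ₁)
    (hsmall : 2 * δ₁ + 2 * g * δ₂ / e ≤ 1 / 2)
    (hv0u0 : 4 * e' * Real.exp (4 * Λ) * v 0 ^ 2 ≤ g * u 0 ^ 2)
    (hβe : 16 * e' * β ^ 2 * Real.exp (4 * Λ) ≤ g * e ^ 2)
    (huh : ∀ s ∈ Icc 0 t, u s ≤ h)
    (hwx : ∀ s ∈ Icc 0 t, 1 - 2 * δ₁ ≤ x s) (hwy : ∀ s ∈ Icc 0 t, y s ≤ 2 * δ₂) :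
    ∀ s ∈ Icc 0 t,
      1 - δ₁ ≤ x s ∧ x s ≤ 1 ∧ y 0 ≤ y s ∧ y s ≤ δ₂ ∧ 0 < u s ∧ 0 ≤ v s ∧
      v s ≤ Real.exp (2 * Λ) * (v 0 + 2 * β * u s / e) ∧
      u 0 * Real.exp (e * (1 - (δ₁ + g * δ₂ / e)) * s) ≤ u s ∧ u s ≤ u 0 * Real.exp (e * s) ∧
      v 0 + β * (1 - δ₁) * (u s - u 0) / e ≤ v s := by
  intro s₀ hs₀
  have ht : 0 ≤ t := hs₀.1.trans hs₀.2
  have h0mem : (0 : ℝ) ∈ Icc 0 t := left_mem_Icc.2 ht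
  have hxc : Continuous x := continuous_iff_continuousAt.2 fun t => (hx t).continuousAt
  have hyc : Continuous y := continuous_iff_continuousAt.2 fun t => (hy t).continuousAt
  -- signs of the constants
  have hδ₂nn : 0 ≤ δ₂ := by
    have : 0 ≤ g * h ^ 2 / e := by
      have := sq_nonneg h
      positivity
    linarith
  have hsmall' : e * (2 * δ₁) + 2 * g * δ₂ ≤ e / 2 := by
    have h1 : e * (2 * δ₁ + 2 * g * δ₂ / e) ≤ e * (1 / 2) := mul_le_mul_of_nonneg_left hsmall he.le
    have h2 : e * (2 * δ₁ + 2 * g * δ₂ / e) = e * (2 * δ₁) + 2 * g * δ₂ := by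
      field_simp
    linarith
  have h2δ₁ : 2 * δ₁ ≤ 1 / 2 := by
    have : 0 ≤ 2 * g * δ₂ / e := by positivity
    linarith
  -- energy and the trigger sign
  have hEs : ∀ s, x s ^ 2 + u s ^ 2 + y s ^ 2 + v s ^ 2 ≤ 1 := fun s => by
    rw [heteroclinicTriggerChain_trunc_energy e g e' β x u y v hx hu hy hv s]; exact hE
  have hxle : ∀ s, x s ≤ 1 := fun s => by
    nlinarith [hEs s, sq_nonneg (u s), sq_nonneg (y s), sq_nonneg (v s), sq_nonneg (x s - 1)]
  have hupos : ∀ s, 0 < u s := fun s => by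
    rw [heteroclinicTriggerChain_trunc_trigger_formula e g x u y hxc hyc hu s]
    exact mul_pos hu0 (Real.exp_pos _)
  have hunn : ∀ s, 0 ≤ u s := fun s => (hupos s).le
  have hu' : ∀ s, HasDerivAt u ((e * x s - g * y s) * u s) s := fun s =>
    (hu s).congr_deriv (by ring)
  -- (1) weak-phase rate bound and `x ≥ 0`
  have hrate : ∀ s ∈ Icc 0 t, e / 2 ≤ e * x s - g * y s := by
    intro s hs
    have h1 : e * (1 - 2 * δ₁) ≤ e * x s := mul_le_mul_of_nonneg_left (hwx s hs) he.le
    have h2 : g * y s ≤ g * (2 * δ₂) := mul_le_mul_of_nonneg_left (hwy s hs) hg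
    linarith
  have hxnn : ∀ s ∈ Icc 0 t, 0 ≤ x s := fun s hs => by linarith [hwx s hs]
  -- (2) trigger non-decreasing, upper trigger nonnegative and bounded
  have humono := htcTP_mono_of_rate_nonneg hu' hunn (t := t) fun s hs => by linarith [hrate s hs]
  have hvnn : ∀ s ∈ Icc 0 t, 0 ≤ v s :=
    htcTP_upper_nonneg hv hyc (fun s hs => mul_nonneg (mul_nonneg hβ (hxnn s hs)) (hunn s)) hv0
  have hvub0 := htcTP_upper_bound he hβ he' hδ₂nn hv hu' hxle hunn hrate hvnn hwy
  have hvub : ∀ s ∈ Icc 0 t, v s ≤ Real.exp (2 * Λ) * (v 0 + 2 * β * u s / e) := by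
    intro s hs
    have h1 := hvub0 s hs
    have h2 : 2 * e' * δ₂ * s ≤ 2 * Λ := by
      have : e' * δ₂ * s ≤ e' * δ₂ * t := mul_le_mul_of_nonneg_left hs.2 (by positivity)
      linarith
    have h3 : 0 ≤ v 0 + 2 * β * u s / e := by
      have := hunn s
      positivity
    exact h1.trans (mul_le_mul_of_nonneg_right (Real.exp_le_exp.2 h2) h3)
  have hvV : ∀ s ∈ Icc 0 t, v s ≤ V := by
    intro s hs
    refine (hvub s hs).trans (le_trans ?_ hV)
    apply mul_le_mul_of_nonneg_left _ (Real.exp_pos _).le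
    have : 2 * β * u s / e ≤ 2 * β * h / e :=
      div_le_div_of_nonneg_right (mul_le_mul_of_nonneg_left (huh s hs) (by positivity)) he.le
    linarith
  have hVnn : 0 ≤ V := (hvnn 0 h0mem).trans (hvV 0 h0mem)
  -- (3) the upper drain is dominated by the pump
  have hdrain : ∀ s ∈ Icc 0 t, e' * v s ^ 2 ≤ g * u s ^ 2 := by
    intro s hs
    have hvs := hvnn s hs
    have hvu := hvub s hs
    have hum := humono s hs
    have hA2 : Real.exp (2 * Λ) ^ 2 = Real.exp (4 * Λ) := by
      rw [sq, ← Real.exp_add]; congr 1; ring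
    have h1 : v s ^ 2 ≤ Real.exp (4 * Λ) * (v 0 + 2 * β * u s / e) ^ 2 := by
      have := pow_le_pow_left₀ hvs hvu 2
      rw [mul_pow, hA2] at this
      exact this
    have h2 : (v 0 + 2 * β * u s / e) ^ 2 ≤ 2 * v 0 ^ 2 + 8 * β ^ 2 * u s ^ 2 / e ^ 2 := by
      have h3 : (v 0 + 2 * β * u s / e) ^ 2 ≤ 2 * v 0 ^ 2 + 2 * (2 * β * u s / e) ^ 2 := by
        nlinarith [sq_nonneg (v 0 - 2 * β * u s / e)]
      have h4 : 2 * (2 * β * u s / e) ^ 2 = 8 * β ^ 2 * u s ^ 2 / e ^ 2 := by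
        field_simp
        ring
      linarith
    have h5 : e' * v s ^ 2 ≤ e' * Real.exp (4 * Λ) * (2 * v 0 ^ 2) +
        e' * Real.exp (4 * Λ) * (8 * β ^ 2 * u s ^ 2 / e ^ 2) := by
      have := mul_le_mul_of_nonneg_left (h1.trans (mul_le_mul_of_nonneg_left h2 (Real.exp_pos _).le)) he'
      have h6 : e' * (Real.exp (4 * Λ) * (2 * v 0 ^ 2 + 8 * β ^ 2 * u s ^ 2 / e ^ 2)) =
          e' * Real.exp (4 * Λ) * (2 * v 0 ^ 2) + e' * Real.exp (4 * Λ) * (8 * β ^ 2 * u s ^ 2 / e ^ 2) := by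
        ring
      linarith
    have h6 : e' * Real.exp (4 * Λ) * (2 * v 0 ^ 2) ≤ g * u s ^ 2 / 2 := by
      have h7 : u 0 ^ 2 ≤ u s ^ 2 := pow_le_pow_left₀ hu0.le hum 2
      have h8 : g * u 0 ^ 2 ≤ g * u s ^ 2 := mul_le_mul_of_nonneg_left h7 hg
      linarith
    have h7 : e' * Real.exp (4 * Λ) * (8 * β ^ 2 * u s ^ 2 / e ^ 2) ≤ g * u s ^ 2 / 2 := by
      have h8 : e' * Real.exp (4 * Λ) * (8 * β ^ 2 * u s ^ 2 / e ^ 2) =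
          (16 * e' * β ^ 2 * Real.exp (4 * Λ)) * u s ^ 2 / (2 * e ^ 2) := by
        field_simp
        ring
      have h9 : g * u s ^ 2 / 2 = (g * e ^ 2) * u s ^ 2 / (2 * e ^ 2) := by
        field_simp
      rw [h8, h9]
      exact div_le_div_of_nonneg_right (mul_le_mul_of_nonneg_right hβe (sq_nonneg _)) (by positivity)
    linarith
  -- (4) receiver and carrier windows
  have hyw := htcTP_receiver_window he hg he' hy hu' hrate hdrain
  have hynn : ∀ s ∈ Icc 0 t, 0 ≤ y s := fun s hs => hy0.trans (hyw s hs).1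
  have hyub : ∀ s ∈ Icc 0 t, y s ≤ δ₂ := by
    intro s hs
    have h1 := (hyw s hs).2
    have h2 : u s ^ 2 ≤ h ^ 2 := pow_le_pow_left₀ (hunn s) (huh s hs) 2
    have h3 : g * (u s ^ 2 - u 0 ^ 2) / e ≤ g * h ^ 2 / e := by
      apply div_le_div_of_nonneg_right _ he.le
      nlinarith [sq_nonneg (u 0), hg]
    linarith
  have hxw := htcTP_carrier_window he hβ hVnn hx hu' hunn hrate hvV
  have hxlb : ∀ s ∈ Icc 0 t, 1 - δ₁ ≤ x s := by
    intro s hs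
    have h1 := hxw s hs
    have h2 : u s ^ 2 ≤ h ^ 2 := pow_le_pow_left₀ (hunn s) (huh s hs) 2
    have h3 : u s ^ 2 - u 0 ^ 2 ≤ h ^ 2 := by nlinarith [sq_nonneg (u 0)]
    have h4 : 2 * β * V * (u s - u 0) / e ≤ 2 * β * V * h / e := by
      apply div_le_div_of_nonneg_right _ he.le
      have : u s - u 0 ≤ h := by linarith [huh s hs, hu0]
      exact mul_le_mul_of_nonneg_left this (by positivity)
    linarith
  -- (5) strong rate bounds, exponential law, collected seed
  have hrate2 : ∀ s ∈ Icc 0 t, e * (1 - (δ₁ + g * δ₂ / e)) ≤ e * x s - g * y s := by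
    intro s hs
    have h1 : e * (1 - δ₁) ≤ e * x s := mul_le_mul_of_nonneg_left (hxlb s hs) he.le
    have h2 : g * y s ≤ g * δ₂ := mul_le_mul_of_nonneg_left (hyub s hs) hg
    have h3 : e * (1 - (δ₁ + g * δ₂ / e)) = e * (1 - δ₁) - g * δ₂ := by
      field_simp
      ring
    linarith
  have hrate3 : ∀ s ∈ Icc 0 t, e * x s - g * y s ≤ e := by
    intro s hs
    have h1 : e * x s ≤ e * 1 := mul_le_mul_of_nonneg_left (hxle s) he.le
    have h2 : 0 ≤ g * y s := mul_nonneg hg (hynn s hs)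
    linarith
  have hulb := htcTP_exp_growth_lower hu' hunn hrate2
  have huub := htcTP_exp_growth_upper hu' hunn hrate3
  have hδ₁le : δ₁ ≤ 1 := by linarith
  have hseed := htcTP_seed_window he hβ he' hδ₁le hv hu' hunn hrate3 hxlb hynn hvnn
  exact ⟨hxlb s₀ hs₀, hxle s₀, (hyw s₀ hs₀).1, hyub s₀ hs₀, hupos s₀, hvnn s₀ hs₀, hvub s₀ hs₀,
    hulb s₀ hs₀, huub s₀ hs₀, hseed s₀ hs₀⟩

end Summit.NavierStokesRegularity.NavierStokesRegularity.Theorems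

end
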